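import Mathlib
import Literature.NumberTheory.EllipticCurves.RealPeriod
import HarnessLib

/-!
# Route TwistAmplification — crux `SomeWindowSaving` (stmt-ABC-1976), line Sketch:
# stub `stub_realPeriodUpperBound` (A0, the real-period upper bound)

For an integral Weierstrass model `W₀` with `Δ ≠ 0` put `M = max(|Δ|, |c₄|³) ≥ 1` and let
`Ω(W₀) = (W₀ ⊗ ℝ).realPeriod = 2 ∫_{ψ > 0} dx/√ψ(x)` (`ψ = 4x³ + b₂x² + 2b₄x + b₆`,
`Literature/NumberTheory/EllipticCurves/RealPeriod.lean`).  We prove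

* `RealPeriodUpperBound.realPeriod_eq_normalized`: for every real model `W` and every `u > 0`,
  `Ω(W) = 2u⁻¹ ∫_{p > 0} ds/√p(s)` with `p(s) = 4s³ − G₂s − G₃`, `G₂ = c₄/(12u⁴)`,
  `G₃ = c₆/(216u⁶)`.  This is the admissible change of variables `x = u²s − b₂/12`
  (Mathlib's `VariableChange ⟨u, −b₂/12, 0, 0⟩`, which kills `b₂` and scales `c₄, c₆` by
  `u⁻⁴, u⁻⁶`) combined with the proved transformation law `Ω(C • W) = |u| Ω(W)`
  (`WeierstrassCurve.realPeriod_smul_holds`).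
* `RealPeriodUpperBound.realPeriod_eq_scaled`: choosing `u¹² = max(|g₂|³, g₃²)` (`g₂ = c₄/12`,
  `g₃ = c₆/216`, not both zero since `g₂³ − 27g₃² = Δ ≠ 0`) normalizes the cubic:
  `|G₂|, |G₃| ≤ 1`, one of them of modulus `1`, `G₂³ − 27G₃² = Δ/u¹² ≠ 0`, and the bookkeeping
  `u¹² ≤ M ≤ 1728 u¹²` (integrality is not used here; only `c₆² = c₄³ − 1728Δ`).
* `stub_realPeriodUpperBound`: GIVEN the bound `∫_{p>0} ds/√p ≤ A + B |log|G₂³ − 27G₃²||` for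
  normalized cubics (a hypothesis here, proved elsewhere on the line),
  `Ω(W₀) ≤ C₀ M^{-1/12} log(2+M)` with `C₀ = 4(A + B log 28 + B)`: indeed `u⁻¹ ≤ 2M^{-1/12}`
  (as `1728 ≤ 2¹²`), `1/M ≤ |G₂³ − 27G₃²| ≤ 28` (as `|Δ| ≥ 1`), and `1 ≤ log(2+M)`.

No integrability is needed anywhere (the change of variables holds for the Bochner integral
unconditionally), and no root of `ψ` is ever computed.  Sources: Silverman, AEC §III.1
(Table 3.1) for the change of variables; the normalization is the classical reduction to
`max(|g₂|³, g₃²) = 1` used in bounding periods by `|Δ|^{-1/12}` (folklore).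
-/

-- `Summit.<Summit>.<Problem>` is the mandated summit-side namespace (CONVENTIONS §2); for the
-- single-conjunct summit `ABC` the two coincide, so the duplicate `ABC.ABC` is deliberate.
set_option linter.dupNamespace false

noncomputable section

open MeasureTheory WeierstrassCurve

namespace Summit.ABC.ABC.Theorems

namespace RealPeriodUpperBound

/-- The two-torsion polynomial after the admissible change of variables `x = u²s − b₂/12`
(Mathlib's `VariableChange ⟨u, −b₂/12, 0, 0⟩`): `ψ'(s) = 4s³ − c₄/(12u⁴)·s − c₆/(216u⁶)`, i.e. the
shift kills `b₂` and the new `b₄' = −c₄'/24`, `b₆' = −c₆'/216` with `c₄' = u⁻⁴c₄`, `c₆' = u⁻⁶c₆`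
(Silverman, AEC §III.1, Table 3.1). [folklore] -/
theorem eval_twoTorsionPolynomial_normalize (W : WeierstrassCurve ℝ) {u : ℝ} (hu : u ≠ 0)
    (x : ℝ) :
    ((⟨Units.mk0 u hu, -W.b₂ / 12, 0, 0⟩ : VariableChange ℝ) • W).twoTorsionPolynomial.toPoly.eval
        x = 4 * x ^ 3 - W.c₄ / 12 / u ^ 4 * x - W.c₆ / 216 / u ^ 6 := by
  rw [eval_twoTorsionPolynomial, variableChange_b₂, variableChange_b₄, variableChange_b₆]
  simp only [Units.val_inv_eq_inv_val, Units.val_mk0, c₄, c₆]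
  field_simp
  ring

/-- **Shift-and-scale reduction of the real period.**  For every real Weierstrass model `W` and
every `u > 0`, `Ω(W) = 2u⁻¹ ∫_{p>0} ds/√p(s)` where `p(s) = 4s³ − G₂s − G₃` with
`G₂ = c₄/(12u⁴)`, `G₃ = c₆/(216u⁶)`.  Proof: `Ω(C • W) = |u| Ω(W)` for `C = ⟨u, −b₂/12, 0, 0⟩`
(`WeierstrassCurve.realPeriod_smul_holds`) and `ψ_{C • W} = p`
(`eval_twoTorsionPolynomial_normalize`).  No integrability hypothesis is needed. [folklore] -/
theorem realPeriod_eq_normalized (W : WeierstrassCurve ℝ) {u : ℝ} (hu : 0 < u) :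
    W.realPeriod = 2 * u⁻¹ *
      ∫ s in {s : ℝ | 0 < 4 * s ^ 3 - W.c₄ / 12 / u ^ 4 * s - W.c₆ / 216 / u ^ 6},
        (Real.sqrt (4 * s ^ 3 - W.c₄ / 12 / u ^ 4 * s - W.c₆ / 216 / u ^ 6))⁻¹ := by
  have h := W.realPeriod_smul_holds ⟨Units.mk0 u hu.ne', -W.b₂ / 12, 0, 0⟩
  rw [Units.val_mk0, abs_of_pos hu] at h
  have hW : W.realPeriod =
      u⁻¹ * ((⟨Units.mk0 u hu.ne', -W.b₂ / 12, 0, 0⟩ : VariableChange ℝ) • W).realPeriod := by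
    rw [h, ← mul_assoc, inv_mul_cancel₀ hu.ne', one_mul]
  rw [hW, realPeriod, twoTorsionSet]
  simp_rw [eval_twoTorsionPolynomial_normalize W hu.ne']
  ring

/-- **Normalized form of the real period of an integral model.**  For `W₀/ℤ` with `Δ ≠ 0` there
are `u > 0` and `G₂, G₃` with `|G₂|, |G₃| ≤ 1`, `max(|G₂|, |G₃|) = 1`,
`G₂³ − 27G₃² ≠ 0`, `|G₂³ − 27G₃²|·u¹² = |Δ|`, `u¹² ≤ M ≤ 1728u¹²` where
`M = max(|Δ|, |c₄|³)`, and `Ω(W₀ ⊗ ℝ) = 2u⁻¹ ∫_{p>0} ds/√p(s)`, `p(s) = 4s³ − G₂s − G₃`.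
(Take `u¹² = max(|g₂|³, g₃²)`, `g₂ = c₄/12`, `g₃ = c₆/216`, `Gᵢ = gᵢ/u^{2i}`; the bookkeeping
uses only `g₂³ − 27g₃² = Δ`, i.e. `c₆² = c₄³ − 1728Δ`.) [folklore] -/
theorem realPeriod_eq_scaled (W₀ : WeierstrassCurve ℤ) (hΔ0 : W₀.Δ ≠ 0) :
    ∃ u G₂ G₃ : ℝ, 0 < u ∧ |G₂| ≤ 1 ∧ |G₃| ≤ 1 ∧ (|G₂| = 1 ∨ |G₃| = 1) ∧
      G₂ ^ 3 - 27 * G₃ ^ 2 ≠ 0 ∧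
      u ^ 12 ≤ ((max |W₀.Δ| (|W₀.c₄| ^ 3) : ℤ) : ℝ) ∧
      ((max |W₀.Δ| (|W₀.c₄| ^ 3) : ℤ) : ℝ) ≤ 1728 * u ^ 12 ∧
      |G₂ ^ 3 - 27 * G₃ ^ 2| * u ^ 12 = |(W₀.Δ : ℝ)| ∧
      (W₀.baseChange ℝ).realPeriod = 2 * u⁻¹ *
        ∫ s in {s : ℝ | 0 < 4 * s ^ 3 - G₂ * s - G₃}, (Real.sqrt (4 * s ^ 3 - G₂ * s - G₃))⁻¹ := by
  set W := W₀.baseChange ℝ with hW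
  set M : ℝ := ((max |W₀.Δ| (|W₀.c₄| ^ 3) : ℤ) : ℝ) with hM_def
  have hc₄ : W.c₄ = (W₀.c₄ : ℝ) := by simp [hW, baseChange]
  have hΔ : W.Δ = (W₀.Δ : ℝ) := by simp [hW, baseChange]
  have hM : M = max |W.Δ| (|W.c₄| ^ 3) := by rw [hM_def, hΔ, hc₄]; push_cast; rfl
  have hΔne : W.Δ ≠ 0 := by rw [hΔ]; exact_mod_cast hΔ0
  have hΔM : |W.Δ| ≤ M := by rw [hM]; exact le_max_left _ _
  have hc4M : |W.c₄| ^ 3 ≤ M := by rw [hM]; exact le_max_right _ _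
  have hrel := W.c_relation
  -- the classical invariants `g₂ = c₄/12`, `g₃ = c₆/216`, `g₂³ − 27g₃² = Δ`
  set g₂ : ℝ := W.c₄ / 12 with hg₂
  set g₃ : ℝ := W.c₆ / 216 with hg₃
  have hdisc : g₂ ^ 3 - 27 * g₃ ^ 2 = W.Δ := by
    have : g₂ ^ 3 - 27 * g₃ ^ 2 = (W.c₄ ^ 3 - W.c₆ ^ 2) / 1728 := by rw [hg₂, hg₃]; ring
    rw [this, ← hrel]; ring
  set m : ℝ := max (|g₂| ^ 3) (g₃ ^ 2) with hm_def
  have hm0 : 0 < m := by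
    rcases eq_or_ne g₃ 0 with h3 | h3
    · have h2 : g₂ ≠ 0 := by
        intro h2; apply hΔne; rw [← hdisc, h2, h3]; norm_num
      exact lt_max_of_lt_left (pow_pos (abs_pos.mpr h2) 3)
    · exact lt_max_of_lt_right (by positivity)
  -- the scaling parameter `u = m^{1/12}`
  set u : ℝ := m ^ ((1 : ℝ) / 12) with hu_def
  have hu0 : 0 < u := Real.rpow_pos_of_pos hm0 _
  have hu12 : u ^ 12 = m := by
    simpa [hu_def, one_div] using Real.rpow_inv_natCast_pow hm0.le (n := 12) (by norm_num)
  have hu4 : 0 < u ^ 4 := pow_pos hu0 4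
  have hu6 : 0 < u ^ 6 := pow_pos hu0 6
  have key := realPeriod_eq_normalized W hu0
  set G₂ : ℝ := W.c₄ / 12 / u ^ 4 with hG₂
  set G₃ : ℝ := W.c₆ / 216 / u ^ 6 with hG₃
  have hG₂abs : |G₂| = |g₂| / u ^ 4 := by rw [hG₂, abs_div, abs_of_pos hu4]
  have hG₃abs : |G₃| = |g₃| / u ^ 6 := by rw [hG₃, abs_div, abs_of_pos hu6]
  have h2le : |g₂| ≤ u ^ 4 := by
    rw [← pow_le_pow_iff_left₀ (abs_nonneg _) hu4.le (by norm_num : (3 : ℕ) ≠ 0), ← pow_mul]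
    norm_num [hu12, hm_def]
  have h3le : |g₃| ≤ u ^ 6 := by
    rw [← pow_le_pow_iff_left₀ (abs_nonneg _) hu6.le (by norm_num : (2 : ℕ) ≠ 0), ← pow_mul,
      sq_abs]
    norm_num [hu12, hm_def]
  have hD : G₂ ^ 3 - 27 * G₃ ^ 2 = W.Δ / m := by
    rw [hG₂, hG₃, ← hdisc, ← hu12, hg₂, hg₃]; field_simp
  refine ⟨u, G₂, G₃, hu0, by rwa [hG₂abs, div_le_one hu4], by rwa [hG₃abs, div_le_one hu6],
    ?_, ?_, ?_, ?_, ?_, key⟩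
  · -- normalization: the larger of `|g₂|³, g₃²` becomes `1`
    rcases le_total (g₃ ^ 2) (|g₂| ^ 3) with h | h
    · left
      have h' : |g₂| ^ 3 = (u ^ 4) ^ 3 := by rw [← pow_mul]; norm_num [hu12, hm_def, max_eq_left h]
      rw [hG₂abs, div_eq_one_iff_eq hu4.ne']
      exact (pow_left_inj₀ (abs_nonneg _) hu4.le (by norm_num)).mp h'
    · right
      have h' : |g₃| ^ 2 = (u ^ 6) ^ 2 := by
        rw [← pow_mul, sq_abs]; norm_num [hu12, hm_def, max_eq_right h]
      rw [hG₃abs, div_eq_one_iff_eq hu6.ne']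
      exact (pow_left_inj₀ (abs_nonneg _) hu6.le (by norm_num)).mp h'
  · rw [hD]; exact div_ne_zero hΔne hm0.ne'
  · -- `u¹² = m ≤ M`: `|g₂|³ = |c₄|³/1728 ≤ M`, `g₃² = (c₄³ − 1728Δ)/46656 ≤ M`
    rw [hu12, hm_def]
    apply max_le
    · have : |g₂| ^ 3 = |W.c₄| ^ 3 / 1728 := by rw [hg₂, abs_div]; norm_num; ring
      rw [this]; linarith [abs_nonneg W.c₄, pow_nonneg (abs_nonneg W.c₄) 3]
    · have h1 : 46656 * g₃ ^ 2 = W.c₆ ^ 2 := by rw [hg₃]; ring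
      have h2 : W.c₄ ^ 3 ≤ |W.c₄| ^ 3 := by rw [← abs_pow]; exact le_abs_self _
      have h3 : -W.Δ ≤ |W.Δ| := neg_le_abs _
      nlinarith [h1, h2, h3, hrel, hΔM, hc4M]
  · -- `M ≤ 1728 m`: `|Δ| ≤ |g₂|³ + 27g₃² ≤ 28m`, `|c₄|³ = 1728|g₂|³ ≤ 1728m`
    rw [hM, hu12]
    apply max_le
    · rw [← hdisc]
      calc |g₂ ^ 3 - 27 * g₃ ^ 2| ≤ |g₂ ^ 3| + |27 * g₃ ^ 2| := abs_sub _ _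
        _ = |g₂| ^ 3 + 27 * g₃ ^ 2 := by
          rw [abs_pow, abs_mul, abs_of_nonneg (sq_nonneg g₃)]; norm_num
        _ ≤ m + 27 * m :=
          add_le_add (le_max_left _ _) (by linarith [le_max_right (|g₂| ^ 3) (g₃ ^ 2)])
        _ ≤ 1728 * m := by linarith
    · have : |W.c₄| ^ 3 = 1728 * |g₂| ^ 3 := by rw [hg₂, abs_div]; norm_num; ring
      rw [this]; linarith [le_max_left (|g₂| ^ 3) (g₃ ^ 2)]
  · rw [hD, abs_div, abs_of_pos hm0, hu12, hΔ, div_mul_cancel₀ _ hm0.ne']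

end RealPeriodUpperBound

/-- **A0 (stub D of line Sketch): real-period upper bound for integral models, from the
normalized period bound.**  If `∫_{p>0} ds/√p ≤ A + B|log|G₂³ − 27G₃²||` for every normalized
cubic `p = 4s³ − G₂s − G₃` (`|G₂|, |G₃| ≤ 1`, one of modulus `1`, non-zero discriminant), then
`Ω(W₀ ⊗ ℝ) ≤ C₀ · M^{-1/12} · log(2 + M)` for every `W₀/ℤ` with `Δ ≠ 0`, `M = max(|Δ|, |c₄|³)`,
with `C₀ = 4(A + B log 28 + B)`.  Proof: `RealPeriodUpperBound.realPeriod_eq_scaled` gives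
`Ω = 2u⁻¹ · (normalized integral)` with `u¹² ≤ M ≤ 1728u¹²` and `|D|u¹² = |Δ| ≥ 1`, whence
`u⁻¹ ≤ 2M^{-1/12}`, `1/M ≤ |D| ≤ 28`, `|log|D|| ≤ log 28 + log(2+M)` and `1 ≤ log(2+M)`.
[folklore] -/
theorem stub_realPeriodUpperBound :
    (∃ A B : ℝ, 0 ≤ A ∧ 0 ≤ B ∧ ∀ G₂ G₃ : ℝ, |G₂| ≤ 1 → |G₃| ≤ 1 → (|G₂| = 1 ∨ |G₃| = 1) →
      G₂ ^ 3 - 27 * G₃ ^ 2 ≠ 0 →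
        ∫ s in {s : ℝ | 0 < 4 * s ^ 3 - G₂ * s - G₃}, (Real.sqrt (4 * s ^ 3 - G₂ * s - G₃))⁻¹ ≤
          A + B * |Real.log (|G₂ ^ 3 - 27 * G₃ ^ 2|)|) →
    ∃ C₀ : ℝ, ∀ W₀ : WeierstrassCurve ℤ, W₀.Δ ≠ 0 →
      (W₀.baseChange ℝ).realPeriod ≤
        C₀ * ((max |W₀.Δ| (|W₀.c₄| ^ 3) : ℤ) : ℝ) ^ (-(1 : ℝ) / 12) *
          Real.log (2 + ((max |W₀.Δ| (|W₀.c₄| ^ 3) : ℤ) : ℝ)) := by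
  rintro ⟨A, B, hA, hB, hI⟩
  refine ⟨4 * (A + B * Real.log 28 + B), fun W₀ hΔ0 ↦ ?_⟩
  obtain ⟨u, G₂, G₃, hu0, hG₂, hG₃, hnorm, hDne, huM, hMu, hDu, hΩ⟩ :=
    RealPeriodUpperBound.realPeriod_eq_scaled W₀ hΔ0
  set M : ℝ := ((max |W₀.Δ| (|W₀.c₄| ^ 3) : ℤ) : ℝ) with hM_def
  have hΔ1 : (1 : ℝ) ≤ |(W₀.Δ : ℝ)| := by exact_mod_cast Int.one_le_abs hΔ0
  have hM1 : 1 ≤ M := by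
    refine hΔ1.trans ?_
    rw [hM_def]; push_cast; exact le_max_left _ _
  have hM0 : 0 < M := one_pos.trans_le hM1
  set D : ℝ := G₂ ^ 3 - 27 * G₃ ^ 2 with hD_def
  have hDpos : 0 < |D| := abs_pos.mpr hDne
  have hu12 : 0 < u ^ 12 := pow_pos hu0 12
  -- `1/M ≤ |D| ≤ 28`
  have hDle : |D| ≤ 28 := by
    calc |D| ≤ |G₂ ^ 3| + |27 * G₃ ^ 2| := abs_sub _ _
      _ = |G₂| ^ 3 + 27 * |G₃| ^ 2 := by rw [abs_pow, abs_mul, abs_pow]; norm_num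
      _ ≤ 1 ^ 3 + 27 * 1 ^ 2 := by gcongr
      _ = 28 := by norm_num
  have hDge : M⁻¹ ≤ |D| := by
    have : |D| = |(W₀.Δ : ℝ)| / u ^ 12 := by rw [← hDu, mul_div_cancel_right₀ _ hu12.ne']
    rw [this, inv_eq_one_div]
    exact div_le_div₀ (abs_nonneg _) hΔ1 hu12 huM
  -- `u⁻¹ ≤ 2 M^{-1/12}` from `M ≤ 1728 u¹² ≤ (2u)¹²`
  have hμ : u⁻¹ ≤ 2 * M ^ (-(1 : ℝ) / 12) := by
    have hp0 : 0 < M ^ ((1 : ℝ) / 12) := Real.rpow_pos_of_pos hM0 _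
    have hp12 : (M ^ ((1 : ℝ) / 12)) ^ 12 = M := by
      simpa [one_div] using Real.rpow_inv_natCast_pow hM0.le (n := 12) (by norm_num)
    have hle : M ^ ((1 : ℝ) / 12) ≤ 2 * u := by
      rw [← pow_le_pow_iff_left₀ hp0.le (by positivity) (by norm_num : (12 : ℕ) ≠ 0), hp12,
        mul_pow]
      norm_num; linarith
    rw [show -(1 : ℝ) / 12 = -((1 : ℝ) / 12) by ring, Real.rpow_neg hM0.le]
    calc u⁻¹ = 2 * (2 * u)⁻¹ := by field_simp
      _ ≤ 2 * (M ^ ((1 : ℝ) / 12))⁻¹ := mul_le_mul_of_nonneg_left (inv_anti₀ hp0 hle) two_pos.le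
  -- logarithms
  have hlogM : 0 ≤ Real.log M := Real.log_nonneg hM1
  have hlog28 : 0 ≤ Real.log 28 := Real.log_nonneg (by norm_num)
  have hℓM : Real.log M ≤ Real.log (2 + M) := Real.log_le_log hM0 (by linarith)
  have hℓ1 : 1 ≤ Real.log (2 + M) := by
    rw [Real.le_log_iff_exp_le (by linarith)]
    have := Real.exp_one_lt_d9
    norm_num at this; linarith
  have hL : |Real.log (|D|)| ≤ Real.log 28 + Real.log (2 + M) := by
    rw [abs_le]
    constructor
    · have := Real.log_le_log (inv_pos.mpr hM0) hDge
      rw [Real.log_inv] at this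
      linarith
    · have := Real.log_le_log hDpos hDle
      linarith
  -- assembly
  have hμ0 : 0 < M ^ (-(1 : ℝ) / 12) := Real.rpow_pos_of_pos hM0 _
  have hIle := hI G₂ G₃ hG₂ hG₃ hnorm hDne
  calc (W₀.baseChange ℝ).realPeriod
      = 2 * u⁻¹ * ∫ s in {s : ℝ | 0 < 4 * s ^ 3 - G₂ * s - G₃},
          (Real.sqrt (4 * s ^ 3 - G₂ * s - G₃))⁻¹ := hΩ
    _ ≤ 2 * u⁻¹ * (A + B * |Real.log (|D|)|) :=
        mul_le_mul_of_nonneg_left hIle (by positivity)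
    _ ≤ 2 * (2 * M ^ (-(1 : ℝ) / 12)) * (A + B * (Real.log 28 + Real.log (2 + M))) := by
        gcongr
    _ ≤ 2 * (2 * M ^ (-(1 : ℝ) / 12)) * ((A + B * Real.log 28 + B) * Real.log (2 + M)) := by
        gcongr
        nlinarith [mul_le_mul_of_nonneg_left hℓ1 hA,
          mul_le_mul_of_nonneg_left hℓ1 (mul_nonneg hB hlog28)]
    _ = 4 * (A + B * Real.log 28 + B) * M ^ (-(1 : ℝ) / 12) * Real.log (2 + M) := by ring

end Summit.ABC.ABC.Theorems

end
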